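import Mathlib

/-!
# Crux `BinomialElusive.BinomialCandidate` (stmt-ValiantsHypothesis-7392), line `registered` —
# stub `stub_crossCap`, piece 5: the second derivative in the kernel direction

For a polynomial `Γ` of total degree `≤ 2` in variables `Y_j`, a point `y₀` and linear forms
`λ_j = Σ_l S_{jl} X_l`, the coefficient of `X_0²` in `Γ(y₀ + λ(X))` is the quadratic part of `Γ`
evaluated at the first column of `S`:
`coeff_{X_0²} Γ(y₀_j + Σ_l S_{jl} X_l) = (homogeneousComponent 2 Γ)(S_{•0})`
(`crossCap_kernelCoefficient`).  With `S e_0 = κ` the kernel vector of the Jacobian this is the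
vector `B(κ, κ)` of the cross-cap condition.

Proof: restrict to the line `X_l = 0` (`l ≥ 1`) — the ring homomorphism
`ℂ[X_0, …, X_n] → ℂ[X]` (`finSuccEquiv` followed by constant coefficients) reads off the
coefficients of the pure powers `X_0^j` — and compute the `X²`-coefficient of
`Γ(a + b X) ∈ ℂ[X]` monomial by monomial (`X²`-coefficient of a product of `≤ 2` affine-linear
factors).  Mathlib only.
-/

-- layout Summits/ValiantsHypothesis/ValiantsHypothesis forces the duplicated namespace component
set_option linter.dupNamespace false

noncomputable section

namespace Summit.ValiantsHypothesis.ValiantsHypothesis.Theorems.BinomialCandidateStubs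

open scoped BigOperators
open MvPolynomial

namespace CrossCap

/-! ## One variable: the `X²`-coefficient of `Γ(a + bX)` -/

section OneVariable

variable {σ : Type*}

/-- Coefficient of a product at the sum of degree bounds. -/
theorem coeff_prod_of_natDegree_le' {ι : Type*} (s : Finset ι) (f : ι → Polynomial ℂ) (n : ι → ℕ)
    (h : ∀ i ∈ s, (f i).natDegree ≤ n i) :
    (∏ i ∈ s, f i).coeff (∑ i ∈ s, n i) = ∏ i ∈ s, (f i).coeff (n i) := by
  classical
  induction s using Finset.induction_on with
  | empty => simp
  | insert a s ha ih =>
    rw [Finset.prod_insert ha, Finset.sum_insert ha, Finset.prod_insert ha,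
      Polynomial.coeff_mul_add_eq_of_natDegree_le (h a (by simp)) ?_, ih fun i hi => h i (by simp [hi])]
    exact (Polynomial.natDegree_prod_le _ _).trans (Finset.sum_le_sum fun i hi => h i (by simp [hi]))

/-- The `X²`-coefficient of the monomial `Π_j (a_j + b_j X)^{d_j}`, `|d| ≤ 2`: it is `b^d` if
`|d| = 2` and `0` otherwise. -/
theorem coeff_two_prod_affine (a b : σ → ℂ) (d : σ →₀ ℕ) (hd : d.degree ≤ 2) :
    (∏ i ∈ d.support, (Polynomial.C (a i) + Polynomial.C (b i) * Polynomial.X) ^ d i).coeff 2 =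
      if d.degree = 2 then ∏ i ∈ d.support, b i ^ d i else 0 := by
  have hdeg1 : ∀ i, (Polynomial.C (a i) + Polynomial.C (b i) * Polynomial.X).natDegree ≤ 1 :=
    fun i => (Polynomial.natDegree_add_le _ _).trans (max_le (by simp)
      ((Polynomial.natDegree_C_mul_le _ _).trans Polynomial.natDegree_X_le))
  have hpow : ∀ i, ((Polynomial.C (a i) + Polynomial.C (b i) * Polynomial.X) ^ d i).natDegree ≤ d i :=
    fun i => (Polynomial.natDegree_pow_le_of_le (d i) (hdeg1 i)).trans (by simp)
  split_ifs with h2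
  · rw [Finsupp.degree_apply] at h2
    rw [← h2, coeff_prod_of_natDegree_le' _ _ _ fun i _ => hpow i]
    refine Finset.prod_congr rfl fun i _ => ?_
    have := Polynomial.coeff_pow_of_natDegree_le (m := d i) (hdeg1 i)
    rw [mul_one] at this
    rw [this]
    simp
  · apply Polynomial.coeff_eq_zero_of_natDegree_lt
    refine lt_of_le_of_lt ((Polynomial.natDegree_prod_le _ _).trans
      (Finset.sum_le_sum fun i _ => hpow i)) ?_
    rw [← Finsupp.degree_apply]
    omega

/-- The `X²`-coefficient of `Γ(a + b X)` is the quadratic part of `Γ` at `b` (`deg Γ ≤ 2`). -/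
theorem coeff_two_aeval_affine (Γ : MvPolynomial σ ℂ) (hΓ : Γ.totalDegree ≤ 2) (a b : σ → ℂ) :
    (MvPolynomial.aeval (fun j => Polynomial.C (a j) + Polynomial.C (b j) * Polynomial.X) Γ).coeff 2 =
      MvPolynomial.eval b (MvPolynomial.homogeneousComponent 2 Γ) := by
  classical
  rw [MvPolynomial.aeval_def, MvPolynomial.eval₂_eq, Polynomial.finsetSum_coeff,
    MvPolynomial.homogeneousComponent_apply, map_sum, Finset.sum_filter]
  refine Finset.sum_congr rfl fun d hd => ?_
  have hdeg : d.degree ≤ 2 := by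
    have h1 := MvPolynomial.le_totalDegree hd
    simp only [Finsupp.sum] at h1
    rw [Finsupp.degree_apply]
    exact h1.trans hΓ
  rw [← Polynomial.C_eq_algebraMap, Polynomial.coeff_C_mul, coeff_two_prod_affine a b d hdeg,
    MvPolynomial.eval_monomial, Finsupp.prod]
  split_ifs <;> simp

end OneVariable

/-! ## Restriction to the `X_0`-line -/

section Restrict

variable {n₀ : ℕ}

/-- The restriction `ℂ[X_0, …, X_{n₀}] → ℂ[X]`, `X_0 ↦ X`, `X_l ↦ 0` (`l ≥ 1`), reads off the
coefficients of the pure powers of `X_0`. -/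
theorem coeff_restrict (G : MvPolynomial (Fin (n₀ + 1)) ℂ) (j : ℕ) :
    (((Polynomial.mapAlgHom (MvPolynomial.aeval (fun _ : Fin n₀ => (0 : ℂ)))).comp
      (MvPolynomial.finSuccEquiv ℂ n₀).toAlgHom) G).coeff j =
      MvPolynomial.coeff (Finsupp.single 0 j) G := by
  rw [AlgHom.comp_apply, Polynomial.coe_mapAlgHom, Polynomial.coeff_map]
  change MvPolynomial.aeval (fun _ : Fin n₀ => (0 : ℂ)) ((MvPolynomial.finSuccEquiv ℂ n₀ G).coeff j) = _
  rw [MvPolynomial.aeval_zero', Algebra.algebraMap_self, RingHom.id_apply,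
    MvPolynomial.constantCoeff_eq, MvPolynomial.finSuccEquiv_coeff_coeff]
  congr 1
  ext l
  refine Fin.cases ?_ (fun i => ?_) l
  · simp
  · simp [Finsupp.cons_succ, Fin.succ_ne_zero]

end Restrict

end CrossCap

open CrossCap in
/-- **The second derivative in the kernel direction** (piece 5 of the stub `stub_crossCap`):
for `Γ` of total degree `≤ 2`, the coefficient of `X_0²` in `Γ(y₀_j + Σ_l S_{jl} X_l)` is the
quadratic part `homogeneousComponent 2 Γ` evaluated at the first column of `S`. -/
theorem crossCap_kernelCoefficient :
    ∀ (n₀ : ℕ) (Γ : MvPolynomial (Fin (n₀ + 1)) ℂ), Γ.totalDegree ≤ 2 →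
      ∀ (y₀ : Fin (n₀ + 1) → ℂ) (S : Matrix (Fin (n₀ + 1)) (Fin (n₀ + 1)) ℂ),
        MvPolynomial.coeff (Finsupp.single 0 2)
          (MvPolynomial.aeval (fun j => MvPolynomial.C (y₀ j) +
            ∑ l, MvPolynomial.C (S j l) * MvPolynomial.X l) Γ) =
        MvPolynomial.eval (fun j => S j 0) (MvPolynomial.homogeneousComponent 2 Γ) := by
  intro n₀ Γ hΓ y₀ S
  set Θ : MvPolynomial (Fin (n₀ + 1)) ℂ →ₐ[ℂ] Polynomial ℂ :=
    (Polynomial.mapAlgHom (MvPolynomial.aeval (fun _ : Fin n₀ => (0 : ℂ)))).comp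
      (MvPolynomial.finSuccEquiv ℂ n₀).toAlgHom with hΘ
  have hX0 : Θ (X 0) = Polynomial.X := by
    simp [hΘ, Polynomial.coe_mapAlgHom, MvPolynomial.finSuccEquiv_X_zero]
  have hXs : ∀ l' : Fin n₀, Θ (X l'.succ) = 0 := fun l' => by
    simp [hΘ, Polynomial.coe_mapAlgHom, MvPolynomial.finSuccEquiv_X_succ]
  have hC : ∀ c : ℂ, Θ (C c) = Polynomial.C c := fun c => by
    rw [← MvPolynomial.algebraMap_eq, AlgHom.commutes, Polynomial.algebraMap_eq]
  have hφ : ∀ j, Θ (C (y₀ j) + ∑ l, C (S j l) * X l) =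
      Polynomial.C (y₀ j) + Polynomial.C (S j 0) * Polynomial.X := by
    intro j
    rw [map_add, map_sum, Fin.sum_univ_succ, hC]
    simp [hX0, hXs, hC]
  calc MvPolynomial.coeff (Finsupp.single 0 2)
        (MvPolynomial.aeval (fun j => C (y₀ j) + ∑ l, C (S j l) * X l) Γ)
      = (Θ (MvPolynomial.aeval (fun j => C (y₀ j) + ∑ l, C (S j l) * X l) Γ)).coeff 2 :=
        (coeff_restrict _ 2).symm
    _ = (MvPolynomial.aeval (fun j => Θ (C (y₀ j) + ∑ l, C (S j l) * X l)) Γ).coeff 2 := by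
        rw [← AlgHom.comp_apply, MvPolynomial.comp_aeval]
    _ = (MvPolynomial.aeval (fun j => Polynomial.C (y₀ j) + Polynomial.C (S j 0) * Polynomial.X)
          Γ).coeff 2 := by simp_rw [hφ]
    _ = MvPolynomial.eval (fun j => S j 0) (MvPolynomial.homogeneousComponent 2 Γ) :=
        coeff_two_aeval_affine Γ hΓ y₀ (fun j => S j 0)

end Summit.ValiantsHypothesis.ValiantsHypothesis.Theorems.BinomialCandidateStubs

end
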